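import Summits.RiemannHypothesis.RiemannHypothesis.Theorems.PfPersistenceSecondLevel
import Summits.RiemannHypothesis.RiemannHypothesis.Theorems.PfPersistenceGalerkinNesting
import HarnessLib

/-!
# PF-persistence (pub-rhpf, CAND seat 3 = VARIATIONAL / M2, gen 10), GAL-3 part 1: NEGATIVE GALERKIN INDEX — the typed notion, its truncation ladder, and the two lowest levels

HONEST FRAMING. Mechanism / rigidity campaign inside Route B (PF persistence); **no claim about RH**. Every
declaration below is PROVED (Lean kernel), RH-free, finite-dimensional linear algebra; nothing is asserted about
`ζ`'s actual served values.

WHAT THIS FILE TYPES AND PROVES. For a datum `d` (a real `(N+1) × (N+1)` matrix at every window) the statement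
"the Galerkin block `d win` has NEGATIVE INDEX AT LEAST `n`":

  `GalerkinNegIndexAtLeast d n win : ∃ v : Fin n → ℝ^{N+1}, ∀ c ≠ 0, (Σ cᵢ vᵢ)ᵀ (d win) (Σ cᵢ vᵢ) < 0`

— the exact Galerkin analogue of the M2 seat's continuum notion `EvenNegIndexAtLeast n a` (`n` even real tests on
`[-a, a]` spanning a negative-definite subspace of `Re Q`).  PROVED here:
* §1 the FORM OF A COMBINATION is the quadratic form of the GRAM-TYPE MATRIX `(vᵢᵀ M vⱼ)` (`form_sum_smul`);
* §2 the index is NESTED UPWARD along the truncation ladder for every weight table (zero-padding,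
  `GalerkinNegIndexAtLeast.succ` / `.mono`), in particular for `ζ`;
* §3 LEVEL ONE: `GalerkinNegIndexAtLeast d 1 win ↔ ε₁(d win) < 0` (`bottomRayleigh`);
* §4 LEVEL TWO (symmetric blocks, dimension `≥ 2`): a negative-definite 2-plane exists `↔ ε₂ < 0`, where
  `ε₂ = secondRayleigh` is the Courant–Fischer second level of `PfPersistenceSecondLevel` (a bottom vector and a
  negative vector orthogonal to it span the plane; conversely every 2-plane meets `u₀^⊥`); at `ζ`:
  `galerkinNegIndexAtLeast_two_iff`.
Part 2 (`PfPersistenceGalerkinNegIndex`) transfers the M2 seat's continuum index INTO the Galerkin tower through the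
Fejér–Galerkin approximants of GAL-1, so that `ε₂^{(N)}(a) < 0` at some window acquires a PROVED arithmetic
sufficient condition (`K ≥ 2` off-line quadruples).  Nothing here or there lowers the RH-strength of an
all-window floor on `ε₁` (Weil's criterion); the campaign's negative-side census is unchanged.
-/

noncomputable section

set_option linter.dupNamespace false

open Set Matrix Finset

namespace Summit.RiemannHypothesis.RiemannHypothesis.Theorems.PfPersistence

/-! ## §1 Combinations and their Gram-type matrix -/

/-- the GRAM-TYPE MATRIX of a finite family of window vectors under a block `M`: `(vᵢᵀ M vⱼ)ᵢⱼ`. [folklore] -/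
def formMatrix {m n : ℕ} (M : Matrix (Fin m) (Fin m) ℝ) (v : Fin n → Fin m → ℝ) : Matrix (Fin n) (Fin n) ℝ :=
  Matrix.of fun i j ↦ v i ⬝ᵥ (M *ᵥ v j)

/-- PROVED: unfolding of a quadratic form as a double sum. [folklore] -/
theorem form_eq_sum_sum {n : ℕ} (B : Matrix (Fin n) (Fin n) ℝ) (c : Fin n → ℝ) :
    c ⬝ᵥ (B *ᵥ c) = ∑ i, ∑ j, c i * c j * B i j := by
  simp only [dotProduct, mulVec, Finset.mul_sum]
  exact Finset.sum_congr rfl fun i _ ↦ Finset.sum_congr rfl fun j _ ↦ by ring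

/-- **PROVED — the form of a combination is the quadratic form of the Gram-type matrix:**
`(Σ cᵢ vᵢ)ᵀ M (Σ cⱼ vⱼ) = cᵀ (vᵢᵀ M vⱼ) c`. [folklore] -/
theorem form_sum_smul {m n : ℕ} (M : Matrix (Fin m) (Fin m) ℝ) (c : Fin n → ℝ) (v : Fin n → Fin m → ℝ) :
    (∑ i, c i • v i) ⬝ᵥ (M *ᵥ ∑ j, c j • v j) = c ⬝ᵥ (formMatrix M v *ᵥ c) := by
  rw [form_eq_sum_sum (formMatrix M v) c]
  simp only [formMatrix, Matrix.of_apply, Matrix.mulVec_sum, Matrix.mulVec_smul, sum_dotProduct,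
    dotProduct_sum, smul_dotProduct, dotProduct_smul, smul_eq_mul, Finset.mul_sum]
  exact Finset.sum_comm.trans (Finset.sum_congr rfl fun i _ ↦ Finset.sum_congr rfl fun j _ ↦ by ring)

/-- **NEGATIVE GALERKIN INDEX AT LEAST `n`** of a datum at a window: `n` window vectors on whose real span the
block's quadratic form is negative definite (negative definiteness forces their independence). The Galerkin twin
of the M2 seat's `EvenNegIndexAtLeast n a`. [folklore] -/
def GalerkinNegIndexAtLeast (d : Datum) (n : ℕ) (win : Window) : Prop :=
  ∃ v : Fin n → Fin (win.N + 1) → ℝ,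
    ∀ c : Fin n → ℝ, c ≠ 0 → (∑ i, c i • v i) ⬝ᵥ (d win *ᵥ ∑ i, c i • v i) < 0

/-- PROVED: matrix form of the definition. [folklore] -/
theorem galerkinNegIndexAtLeast_iff_formMatrix (d : Datum) (n : ℕ) (win : Window) :
    GalerkinNegIndexAtLeast d n win ↔
      ∃ v : Fin n → Fin (win.N + 1) → ℝ, ∀ c : Fin n → ℝ, c ≠ 0 → c ⬝ᵥ (formMatrix (d win) v *ᵥ c) < 0 := by
  simp only [GalerkinNegIndexAtLeast, form_sum_smul]

/-- PROVED: index `≥ 0` always. [folklore] -/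
theorem galerkinNegIndexAtLeast_zero (d : Datum) (win : Window) : GalerkinNegIndexAtLeast d 0 win :=
  ⟨Fin.elim0, fun c hc ↦ absurd (Subsingleton.elim c 0) hc⟩

/-- PROVED: the index notion is monotone in `n` (drop the last vector). [folklore] -/
theorem GalerkinNegIndexAtLeast.of_succ {d : Datum} {n : ℕ} {win : Window}
    (h : GalerkinNegIndexAtLeast d (n + 1) win) : GalerkinNegIndexAtLeast d n win := by
  obtain ⟨v, hv⟩ := h
  refine ⟨fun i ↦ v i.castSucc, fun c hc ↦ ?_⟩
  have hc' : (Fin.snoc c 0 : Fin (n + 1) → ℝ) ≠ 0 := snoc_zero_ne_zero' hc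
  have key : (∑ i : Fin (n + 1), (Fin.snoc c 0 : Fin (n + 1) → ℝ) i • v i) = ∑ i : Fin n, c i • v i.castSucc := by
    rw [Fin.sum_univ_castSucc]
    simp [Fin.snoc_castSucc, Fin.snoc_last]
  have := hv _ hc'
  rwa [key] at this
where
  /-- zero-padding a nonzero coefficient vector keeps it nonzero -/
  snoc_zero_ne_zero' {n : ℕ} {c : Fin n → ℝ} (hc : c ≠ 0) : (Fin.snoc c 0 : Fin (n + 1) → ℝ) ≠ 0 := by
    intro h
    apply hc
    funext i
    have := congr_fun h i.castSucc
    simpa [Fin.snoc_castSucc] using this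

/-! ## §2 The truncation ladder: zero-padding raises `N` and keeps the index -/

/-- PROVED: zero-padding is linear on combinations. [folklore] -/
theorem snoc_zero_sum_smul {N n : ℕ} (c : Fin n → ℝ) (v : Fin n → Fin (N + 1) → ℝ) :
    (Fin.snoc (∑ i, c i • v i) 0 : Fin (N + 1 + 1) → ℝ) = ∑ i, c i • (Fin.snoc (v i) 0 : Fin (N + 1 + 1) → ℝ) := by
  funext j
  refine Fin.lastCases ?_ (fun j ↦ ?_) j
  · simp [Fin.snoc_last, Finset.sum_apply]
  · simp [Fin.snoc_castSucc, Finset.sum_apply]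

/-- **PROVED — one rung up** (every weight table): negative index `≥ n` at `(a, N)` gives the same at `(a, N+1)`
(pad the vectors by a zero coordinate; the form is unchanged, `datumOf_form_snoc_zero`). [folklore] -/
theorem GalerkinNegIndexAtLeast.succ (w : Weights) {n : ℕ} {a : ℝ} {ha : 0 < a} {N : ℕ}
    (h : GalerkinNegIndexAtLeast (datumOf w) n ⟨a, N, ha⟩) : GalerkinNegIndexAtLeast (datumOf w) n ⟨a, N + 1, ha⟩ := by
  obtain ⟨v, hv⟩ := h
  refine ⟨fun i ↦ (Fin.snoc (v i) 0 : Fin (N + 1 + 1) → ℝ), fun c hc ↦ ?_⟩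
  have h1 := hv c hc
  rw [← datumOf_form_snoc_zero w a ha N] at h1
  simpa only [snoc_zero_sum_smul] using h1

/-- **PROVED — the index is NESTED UPWARD along the truncation ladder** (every weight table). [folklore] -/
theorem GalerkinNegIndexAtLeast.mono (w : Weights) {n : ℕ} {a : ℝ} {ha : 0 < a} {N N' : ℕ} (hNN' : N ≤ N')
    (h : GalerkinNegIndexAtLeast (datumOf w) n ⟨a, N, ha⟩) : GalerkinNegIndexAtLeast (datumOf w) n ⟨a, N', ha⟩ := by
  induction hNN' with
  | refl => exact h
  | step _ ih => exact ih.succ w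

/-- PROVED: the same at `ζ` (`zetaDatum = datumOf zetaWeights`): once the index is `≥ n` at `(a, N₀)` it is
`≥ n` at every `(a, N)`, `N ≥ N₀`. [folklore] -/
theorem zeta_galerkinNegIndexAtLeast_mono {n : ℕ} {a : ℝ} {ha : 0 < a} {N N' : ℕ} (hNN' : N ≤ N')
    (h : GalerkinNegIndexAtLeast zetaDatum n ⟨a, N, ha⟩) : GalerkinNegIndexAtLeast zetaDatum n ⟨a, N', ha⟩ :=
  GalerkinNegIndexAtLeast.mono zetaWeights hNN' h

/-! ## §3 Level one: a negative direction is exactly `ε₁ < 0` -/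

/-- PROVED: a negative direction exists iff the bottom Rayleigh value is negative. [folklore] -/
theorem exists_form_neg_iff_bottomRayleigh_neg {N : ℕ} (M : Matrix (Fin (N + 1)) (Fin (N + 1)) ℝ) :
    (∃ v : Fin (N + 1) → ℝ, v ⬝ᵥ (M *ᵥ v) < 0) ↔ bottomRayleigh M < 0 := by
  constructor
  · rintro ⟨v, hv⟩
    have hv0 : v ≠ 0 := by rintro rfl; simp at hv
    have h1 := bottomRayleigh_mul_le_form M v
    have h2 := dotSelf_pos_of_ne_zero hv0
    by_contra h
    push Not at h
    nlinarith [mul_nonneg h h2.le]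
  · intro h
    rw [bottomRayleigh_eq_sInf] at h
    obtain ⟨r, ⟨v, hv0, rfl⟩, hr⟩ := exists_lt_of_csInf_lt (rayleighSet_nonempty M) h
    refine ⟨v, ?_⟩
    have h2 := dotSelf_pos_of_ne_zero hv0
    rwa [div_lt_iff₀ h2, zero_mul] at hr

/-- **PROVED — LEVEL ONE: `GalerkinNegIndexAtLeast d 1 win ↔ ε₁(d win) < 0`.** [folklore] -/
theorem galerkinNegIndexAtLeast_one_iff (d : Datum) (win : Window) :
    GalerkinNegIndexAtLeast d 1 win ↔ bottomRayleigh (d win) < 0 := by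
  rw [← exists_form_neg_iff_bottomRayleigh_neg]
  constructor
  · rintro ⟨v, hv⟩
    refine ⟨v 0, ?_⟩
    have h := hv (fun _ ↦ 1) (by simp [funext_iff])
    simpa [Fin.sum_univ_one] using h
  · rintro ⟨v, hv⟩
    refine ⟨fun _ ↦ v, fun c hc ↦ ?_⟩
    have hc0 : c 0 ≠ 0 := by
      contrapose! hc
      funext i
      rw [Subsingleton.elim i 0, hc]
      rfl
    have h2 : 0 < c 0 * c 0 := mul_self_pos.2 hc0
    simp only [Fin.sum_univ_one, Matrix.mulVec_smul, smul_dotProduct, dotProduct_smul, smul_eq_mul]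
    nlinarith [mul_neg_of_pos_of_neg h2 hv]

/-! ## §4 Level two: a negative-definite 2-plane is exactly `ε₂ < 0` -/

/-- PROVED: a pair as a `Fin 2`-family — its combinations are `c₀ • x + c₁ • y`. [folklore] -/
theorem sum_smul_pair {m : ℕ} (x y : Fin m → ℝ) (c : Fin 2 → ℝ) :
    (∑ i, c i • (![x, y] : Fin 2 → Fin m → ℝ) i) = c 0 • x + c 1 • y := by
  simp [Fin.sum_univ_two]

/-- **PROVED — a bottom vector and a negative vector orthogonal to it span a NEGATIVE-DEFINITE 2-plane**
(symmetric block): the cross term vanishes (`form_add_smul_of_isBottomVector_of_orth`). [folklore] -/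
theorem negDef_pair_of_isBottomVector_of_orth {m : ℕ} {M : Matrix (Fin m) (Fin m) ℝ} (hM : M.IsSymm)
    {u₀ w : Fin m → ℝ} (hu₀ : IsBottomVector M u₀) (hw : w ⬝ᵥ u₀ = 0) (hneg₁ : u₀ ⬝ᵥ (M *ᵥ u₀) < 0)
    (hneg₂ : w ⬝ᵥ (M *ᵥ w) < 0) (c : Fin 2 → ℝ) (hc : c ≠ 0) :
    (∑ i, c i • (![u₀, w] : Fin 2 → Fin m → ℝ) i) ⬝ᵥ (M *ᵥ ∑ i, c i • (![u₀, w] : Fin 2 → Fin m → ℝ) i) < 0 := by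
  rw [sum_smul_pair, form_add_smul_of_isBottomVector_of_orth hM hu₀ hw (c 0) (c 1), ← form_eq_of_isBottomVector hu₀]
  have h0 : 0 ≤ c 0 * c 0 := mul_self_nonneg _
  have h1 : 0 ≤ c 1 * c 1 := mul_self_nonneg _
  by_cases hc0 : c 0 = 0
  · have hc1 : c 1 ≠ 0 := by
      contrapose! hc
      funext i
      fin_cases i <;> simp [hc0, hc]
    have h1' : 0 < c 1 * c 1 := mul_self_pos.2 hc1
    rw [hc0, mul_zero, zero_mul, zero_add]
    exact mul_neg_of_pos_of_neg h1' hneg₂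
  · have h0' : 0 < c 0 * c 0 := mul_self_pos.2 hc0
    nlinarith [mul_neg_of_pos_of_neg h0' hneg₁, mul_nonpos_of_nonneg_of_nonpos h1 hneg₂.le]

/-- **PROVED — LEVEL TWO, abstract: a negative-definite 2-plane exists iff `ε₂ < 0`** (symmetric block of
dimension `≥ 2`; `ε₂ = secondRayleigh`, the Courant–Fischer second level). `→`: every 2-plane meets `u₀^⊥`
non-trivially (`exists_comb_dotProduct_eq_zero`) and `ε₂ |w|² ≤ wᵀMw` there; `←`: `ε₁ ≤ ε₂ < 0` makes a bottom
vector negative, the constrained infimum `ε₂ < 0` supplies a negative `w ⊥ u₀`, and the pair is negative definite.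
[folklore] -/
theorem exists_negDef_pair_iff_secondRayleigh_neg {N : ℕ} (hN : 0 < N) {M : Matrix (Fin (N + 1)) (Fin (N + 1)) ℝ}
    (hM : M.IsSymm) :
    (∃ v : Fin 2 → Fin (N + 1) → ℝ,
        ∀ c : Fin 2 → ℝ, c ≠ 0 → (∑ i, c i • v i) ⬝ᵥ (M *ᵥ ∑ i, c i • v i) < 0) ↔
      secondRayleigh M < 0 := by
  obtain ⟨u₀, hu₀, -⟩ := exists_isBottomVector_of_isSymm hM
  constructor
  · rintro ⟨v, hv⟩
    obtain ⟨α, β, hαβ, horth⟩ := exists_comb_dotProduct_eq_zero (v 0) (v 1) u₀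
    set c : Fin 2 → ℝ := ![α, β] with hcdef
    have hc : c ≠ 0 := by
      rcases hαβ with hα | hβ
      · intro h; exact hα (by simpa [hcdef] using congr_fun h 0)
      · intro h; exact hβ (by simpa [hcdef] using congr_fun h 1)
    have hsum : (∑ i, c i • v i) = α • v 0 + β • v 1 := by simp [hcdef, Fin.sum_univ_two]
    have hneg := hv c hc
    rw [hsum] at hneg
    set w := α • v 0 + β • v 1 with hwdef
    have hw0 : w ≠ 0 := by rintro h; rw [h] at hneg; simp at hneg
    have h1 := secondRayleigh_mul_le_form_of_orth hN hM hu₀ horth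
    have h2 := dotSelf_pos_of_ne_zero hw0
    by_contra h
    push Not at h
    nlinarith [mul_nonneg h h2.le]
  · intro h2
    have h1 : bottomRayleigh M < 0 := (bottomRayleigh_le_secondRayleigh hN M).trans_lt h2
    have hneg₁ : u₀ ⬝ᵥ (M *ᵥ u₀) < 0 := by
      rw [form_eq_of_isBottomVector hu₀]
      exact mul_neg_of_neg_of_pos h1 (dotSelf_pos_of_ne_zero hu₀.1)
    rw [secondRayleigh_eq_sInf_orthRayleighSet hN hM hu₀] at h2
    obtain ⟨r, ⟨w, hw0, hw, rfl⟩, hr⟩ := exists_lt_of_csInf_lt (orthRayleighSet_nonempty hN M u₀) h2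
    have hneg₂ : w ⬝ᵥ (M *ᵥ w) < 0 := by
      rwa [div_lt_iff₀ (dotSelf_pos_of_ne_zero hw0), zero_mul] at hr
    exact ⟨![u₀, w], negDef_pair_of_isBottomVector_of_orth hM hu₀ hw hneg₁ hneg₂⟩

/-- **PROVED — LEVEL TWO at `ζ`: `GalerkinNegIndexAtLeast ζ 2 (a, N) ↔ ε₂^{(N)}(a) < 0`** (`N ≥ 1`). [folklore] -/
theorem galerkinNegIndexAtLeast_two_iff (win : Window) (hN : 0 < win.N) :
    GalerkinNegIndexAtLeast zetaDatum 2 win ↔ secondRayleigh (zetaDatum win) < 0 :=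
  exists_negDef_pair_iff_secondRayleigh_neg hN (zetaDatum_isSymm win)

/-- PROVED: the same for any symmetric datum (every member of `dialSpace` is symmetric window-wise; stated for an
explicitly symmetric block). [folklore] -/
theorem galerkinNegIndexAtLeast_two_iff_of_isSymm (d : Datum) (win : Window) (hN : 0 < win.N)
    (hd : (d win).IsSymm) : GalerkinNegIndexAtLeast d 2 win ↔ secondRayleigh (d win) < 0 :=
  exists_negDef_pair_iff_secondRayleigh_neg hN hd

/-- **PROVED — at `ζ`, a negative-definite 2-plane at `(a, N₀)` forces `ε₂^{(N)}(a) < 0` for EVERY `N ≥ max N₀ 1`**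
(nesting + level two). [folklore] -/
theorem zeta_secondRayleigh_neg_of_galerkinNegIndexAtLeast_two {a : ℝ} {ha : 0 < a} {N₀ : ℕ}
    (h : GalerkinNegIndexAtLeast zetaDatum 2 ⟨a, N₀, ha⟩) {N : ℕ} (hN : N₀ ≤ N) (hN1 : 0 < N) :
    secondRayleigh (zetaDatum ⟨a, N, ha⟩) < 0 :=
  (galerkinNegIndexAtLeast_two_iff ⟨a, N, ha⟩ hN1).1 (zeta_galerkinNegIndexAtLeast_mono hN h)

/-- **PROVED — at `ζ`, a negative direction at `(a, N₀)` forces `ε₁^{(N)}(a) < 0` for every `N ≥ N₀`.** [folklore] -/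
theorem zeta_bottomRayleigh_neg_of_galerkinNegIndexAtLeast_one {a : ℝ} {ha : 0 < a} {N₀ : ℕ}
    (h : GalerkinNegIndexAtLeast zetaDatum 1 ⟨a, N₀, ha⟩) {N : ℕ} (hN : N₀ ≤ N) :
    bottomRayleigh (zetaDatum ⟨a, N, ha⟩) < 0 :=
  (galerkinNegIndexAtLeast_one_iff zetaDatum ⟨a, N, ha⟩).1 (zeta_galerkinNegIndexAtLeast_mono hN h)

end Summit.RiemannHypothesis.RiemannHypothesis.Theorems.PfPersistence
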